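import Mathlib
import Summits.AnomalousDissipation.AnomalousDissipation.Theses.TaylorCertificates
import Literature.Analysis.FunctionSpaces.TorusTrigPoly
import Literature.Analysis.FunctionSpaces.TorusFourierModes
import Literature.Analysis.FunctionSpaces.TorusDirichletKernel
import Summits.AnomalousDissipation.AnomalousDissipation.Theorems.TaylorCertificatesPacketLemmaFejer
import Summits.AnomalousDissipation.AnomalousDissipation.Theorems.TaylorCertificatesPacketLemmaEnvelope
import Summits.AnomalousDissipation.AnomalousDissipation.Theorems.TaylorCertificatesPacketLemmaStrain
import Summits.AnomalousDissipation.AnomalousDissipation.Theorems.TaylorCertificatesPacketLemmaPacket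
import Summits.AnomalousDissipation.AnomalousDissipation.Theorems.TaylorCertificatesPacketLemmaEstimates
import Summits.AnomalousDissipation.AnomalousDissipation.Theorems.TaylorCertificatesPacketLemmaCarrier
import HarnessLib

/-!
# Route TaylorCertificates — proof of the support `PacketLemma`

`packetLemma_proof : Summit.AnomalousDissipation.AnomalousDissipation.Theses.TaylorCertificates.PacketLemma`
(item stmt-AnomalousDissipation-14032), with the absolute constant `K₁ = 2²³`.

Given `D ≥ 1`, a smooth divergence-free `W` with `P_D W = W` whose strain form is bounded by `s`
on unit vectors, a point `x₀` and a unit vector `ξ`, the witness is the normalised curl packet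
`ŵ = N^{-1/2} w₀`, `w₀ = ∇(Im(ψ e_p)) × a` (the real trigonometric polynomial of
`TaylorCertificatesPacketLemmaPacket`), where

* `ψ(x) = ∏ᵢ |χ_M(xᵢ - x₀ᵢ)|²` is the product Fejér–Jackson envelope with `M + 1 = 2¹⁰ D`
  (`TaylorCertificatesPacketLemmaEnvelope`);
* the carrier `p ∈ ℤ³` is the coordinatewise rounding of `2²² D · u` for a unit vector `u ⊥ ξ`,
  so that `|⟪p, ξ⟫| ≤ 1` and `2²² D - 1 ≤ |p| ≤ 2²² D + 1`;
* `a = (ξ × p)/|ξ × p|`, so that `P = p × a` has `|P| = |p|` and direction within `O(1/|p|)` of `ξ`.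

Divergence-freeness, zero mean and the spectral window `{2D < |k| ≤ 2²³ D}` are read off the
coefficients; `∫ ‖ŵ‖² = 1` by construction; and `packet_estimates` gives
`∫ ⟪ŵ, (ŵ·∇)W⟫ ≤ ⟪ξ, (ξ·∇)W(x₀)⟫ + c s` with an explicit `c < 1/4`.

The finite-dimensional choices (frame, carrier, rounding, ratio bookkeeping) are in
`TaylorCertificatesPacketLemmaCarrier`. No definitions, no named facts.
-/

noncomputable section

open MeasureTheory UnitAddTorus Complex Real
open scoped ComplexConjugate Pointwise

namespace Summit.AnomalousDissipation.AnomalousDissipation.Theorems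

-- the mandated namespace `Summit.<Summit>.<Problem>.Theorems` repeats `AnomalousDissipation` (single-problem summit)
set_option linter.dupNamespace false

open Literature.Analysis.FunctionSpaces Literature.Analysis.FunctionSpaces.Torus

/-! ### The normalised packet -/

/-- **Qualitative properties of a normalised packet.** For a frequency set `S` avoiding the origin
and lying in the shell `(2D)² < |m|² ≤ (K D)²`, and transversal-by-construction coefficients
`c_m = σ_m • complexify (m × a)`, the real trigonometric polynomial `realTrigPoly S c` is smooth,
divergence free, of zero mean, killed by `P_{2D}` and fixed by `P_{KD}`. [folklore] -/
theorem packet_qualitative {S : Finset (Fin 3 → ℤ)} {D K : ℕ} (h0 : (0 : Fin 3 → ℤ) ∉ S)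
    (hlo : ∀ m ∈ S, ((2 * D : ℕ) : ℝ) ^ 2 < freqNormSq m) (hhi : ∀ m ∈ S, freqNormSq m ≤ ((K * D : ℕ) : ℝ) ^ 2)
    (σ : (Fin 3 → ℤ) → ℂ) (a : EuclideanSpace ℝ (Fin 3)) (c : (Fin 3 → ℤ) → EuclideanSpace ℂ (Fin 3))
    (hc : ∀ m, c m = σ m • EuclideanSpace.complexify
      (WithLp.toLp 2 (crossProduct (WithLp.ofLp (latticeVec m)) (WithLp.ofLp a)) : EuclideanSpace ℝ (Fin 3))) :
    IsSmooth (realTrigPoly S c) ∧ IsDivFree (realTrigPoly S c) ∧ HasZeroMean (realTrigPoly S c) ∧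
      fourierTruncate (2 * D) (realTrigPoly S c) = 0 ∧ fourierTruncate (K * D) (realTrigPoly S c) = realTrigPoly S c :=
  ⟨isSmooth_realTrigPoly S c, isDivFree_realTrigPoly (isTransversal_packetCoeff S σ a c hc),
    hasZeroMean_realTrigPoly h0 c, fourierTruncate_realTrigPoly_eq_zero hlo c,
    fourierTruncate_realTrigPoly_eq_self hhi c⟩

/-- **Normalisation.** If `ŵ = N^{-1/2} w₀` pointwise with `N = ∫ ‖w₀‖² > 0`, then `∫ ‖ŵ‖² = 1`
and `∫ ⟪ŵ, (ŵ·∇)W⟫ = (∫ ⟪w₀, (w₀·∇)W⟫)/N`. [folklore] -/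
theorem packet_normalisation (W w₀ ŵ : UnitAddTorus (Fin 3) → EuclideanSpace ℝ (Fin 3))
    {N : ℝ} (hN : N = ∫ x, ‖w₀ x‖ ^ 2) (hNpos : 0 < N)
    (hŵ : ∀ x, ŵ x = (Real.sqrt N)⁻¹ • w₀ x) :
    ∫ x, ‖ŵ x‖ ^ 2 = 1 ∧
      ∫ x, inner ℝ (ŵ x) (convect ŵ W x) = (∫ x, inner ℝ (w₀ x) (convect w₀ W x)) / N := by
  have hl2 : ((Real.sqrt N)⁻¹) ^ 2 = N⁻¹ := by
    rw [inv_pow, Real.sq_sqrt hNpos.le]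
  constructor
  · have h : ∀ x, ‖ŵ x‖ ^ 2 = N⁻¹ * ‖w₀ x‖ ^ 2 := fun x => by
      rw [hŵ, norm_smul, mul_pow, norm_inv, Real.norm_eq_abs, abs_of_nonneg (Real.sqrt_nonneg _), hl2]
    simp_rw [h]
    rw [integral_const_mul, ← hN, inv_mul_cancel₀ hNpos.ne']
  · have h : ∀ x, inner ℝ (ŵ x) (convect ŵ W x) = N⁻¹ * inner ℝ (w₀ x) (convect w₀ W x) := fun x => by
      simp only [convect, hŵ, map_smul, inner_smul_left, inner_smul_right, conj_trivial]
      rw [← mul_assoc, ← sq, hl2]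
    simp_rw [h]
    rw [integral_const_mul, div_eq_inv_mul]

/-- **The error budget** (pure arithmetic): with `M + 1 = 2¹⁰ D`, `D ≥ 1`, `‖P‖ ≥ 2²² D - 1` and
`ε = π²/(2(M+1))`, the quantities `μ = 2/‖P‖`, `δ = 7(M+1)/‖P‖ + 6(M+1)²/‖P‖²`,
`κ = 6Dε + δ` satisfy `δ ≤ 1/2` and `μ + κ + 2δ(1+κ) ≤ 1/4`. [folklore] -/
theorem error_budget {D M : ℕ} (hD : 1 ≤ D) (hM : M + 1 = 2 ^ 10 * D) {nP : ℝ}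
    (hP : (2 : ℝ) ^ 22 * D - 1 ≤ nP) :
    7 * ((M : ℝ) + 1) / nP + 6 * ((M : ℝ) + 1) ^ 2 / nP ^ 2 ≤ 2⁻¹ ∧
      2 / nP + (6 * D * (π ^ 2 / (2 * ((M : ℝ) + 1))) + (7 * ((M : ℝ) + 1) / nP + 6 * ((M : ℝ) + 1) ^ 2 / nP ^ 2)) +
        2 * (7 * ((M : ℝ) + 1) / nP + 6 * ((M : ℝ) + 1) ^ 2 / nP ^ 2) *
          (1 + (6 * D * (π ^ 2 / (2 * ((M : ℝ) + 1))) +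
            (7 * ((M : ℝ) + 1) / nP + 6 * ((M : ℝ) + 1) ^ 2 / nP ^ 2))) ≤ 4⁻¹ := by
  have hDr : (1 : ℝ) ≤ D := by exact_mod_cast hD
  have hMr : (M : ℝ) + 1 = 2 ^ 10 * D := by exact_mod_cast hM
  have hnP : (2 : ℝ) ^ 21 * D ≤ nP := by linarith
  have hnP0 : 0 < nP := by linarith
  -- `(M+1)/nP ≤ 2^{-11}`
  have hy : ((M : ℝ) + 1) / nP ≤ 1 / 2 ^ 11 := by
    rw [div_le_div_iff₀ hnP0 (by positivity)]; nlinarith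
  have hy0 : 0 ≤ ((M : ℝ) + 1) / nP := by positivity
  have hy2 : ((M : ℝ) + 1) ^ 2 / nP ^ 2 ≤ 1 / 2 ^ 22 := by
    rw [← div_pow]
    calc (((M : ℝ) + 1) / nP) ^ 2 ≤ (1 / 2 ^ 11) ^ 2 := pow_le_pow_left₀ hy0 hy 2
      _ = 1 / 2 ^ 22 := by norm_num
  have hμ : 2 / nP ≤ 2 / 2 ^ 21 := by
    rw [div_le_div_iff₀ hnP0 (by positivity)]; nlinarith
  have hε : 6 * D * (π ^ 2 / (2 * ((M : ℝ) + 1))) = 3 * π ^ 2 / 2 ^ 10 := by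
    rw [hMr]; field_simp; ring
  rw [hε]
  have hπ := pi_sq_le_ten
  have h7 : 7 * ((M : ℝ) + 1) / nP = 7 * (((M : ℝ) + 1) / nP) := by ring
  have h6 : 6 * ((M : ℝ) + 1) ^ 2 / nP ^ 2 = 6 * (((M : ℝ) + 1) ^ 2 / nP ^ 2) := by ring
  rw [h7, h6]
  have hδ : 7 * (((M : ℝ) + 1) / nP) + 6 * (((M : ℝ) + 1) ^ 2 / nP ^ 2) ≤ 1 / 256 := by
    nlinarith
  have hδ0 : 0 ≤ 7 * (((M : ℝ) + 1) / nP) + 6 * (((M : ℝ) + 1) ^ 2 / nP ^ 2) := by positivity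
  constructor
  · linarith
  · nlinarith [mul_nonneg hδ0 (by positivity : (0:ℝ) ≤ π ^ 2)]

/-- **The final inequality** (real arithmetic): the two estimates of `packet_estimates`, the
comparison `ĝ ≤ g + 2s/‖P‖` of the quadratic form in the packet direction with the target
direction, and the error budget give `F₀/N ≤ g + s/4`. [folklore] -/
theorem final_inequality {F₀ N Z s g ĝ nP ε : ℝ} {D M : ℕ} (hZ : 0 < Z) (hnP : 0 < nP) (hs0 : 0 ≤ s)
    (hε0 : 0 < ε)
    (hF : F₀ ≤ 2 * π ^ 2 * (nP ^ 2 * ĝ) * Z +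
      s * (12 * π ^ 2 * D * ε * nP ^ 2 + 14 * π ^ 2 * (M + 1) * nP + 12 * π ^ 2 * (M + 1) ^ 2) * Z)
    (hNlo : 2 * π ^ 2 * nP ^ 2 * Z - 14 * π ^ 2 * (M + 1) * nP * Z ≤ N)
    (hNhi : N ≤ 2 * π ^ 2 * nP ^ 2 * Z + 14 * π ^ 2 * (M + 1) * nP * Z + 12 * π ^ 2 * (M + 1) ^ 2 * Z)
    (hĝ : |ĝ| ≤ s) (hĝg : ĝ ≤ g + s * (2 / nP))
    (hδhalf : 7 * ((M : ℝ) + 1) / nP + 6 * ((M : ℝ) + 1) ^ 2 / nP ^ 2 ≤ 2⁻¹)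
    (hbudget : 2 / nP + (6 * D * ε + (7 * ((M : ℝ) + 1) / nP + 6 * ((M : ℝ) + 1) ^ 2 / nP ^ 2)) +
        2 * (7 * ((M : ℝ) + 1) / nP + 6 * ((M : ℝ) + 1) ^ 2 / nP ^ 2) *
          (1 + (6 * D * ε + (7 * ((M : ℝ) + 1) / nP + 6 * ((M : ℝ) + 1) ^ 2 / nP ^ 2))) ≤ 4⁻¹) :
    F₀ / N ≤ g + s / 4 := by
  obtain ⟨δ, hδ⟩ : ∃ δ : ℝ, δ = 7 * ((M : ℝ) + 1) / nP + 6 * ((M : ℝ) + 1) ^ 2 / nP ^ 2 := ⟨_, rfl⟩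
  rw [← hδ] at hδhalf hbudget
  have hδ0 : 0 ≤ δ := by rw [hδ]; positivity
  obtain ⟨X, hX⟩ : ∃ X : ℝ, X = 2 * π ^ 2 * nP ^ 2 * Z := ⟨_, rfl⟩
  have hXpos : 0 < X := by rw [hX]; positivity
  have hXδ : X * δ = 14 * π ^ 2 * ((M : ℝ) + 1) * nP * Z + 12 * π ^ 2 * ((M : ℝ) + 1) ^ 2 * Z := by
    rw [hX, hδ]; field_simp; ring
  have h12 : 0 ≤ 12 * π ^ 2 * ((M : ℝ) + 1) ^ 2 * Z := by positivity
  have hNlo' : X * (1 - δ) ≤ N := by rw [mul_sub, mul_one, hXδ]; linarith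
  have hNhi' : N ≤ X * (1 + δ) := by rw [mul_add, mul_one, hXδ]; linarith
  have hκ0 : 0 ≤ 6 * (D : ℝ) * ε + δ := by positivity
  have hF' : F₀ ≤ X * (ĝ + s * (6 * D * ε + δ)) := by
    have hXκ : X * (s * (6 * D * ε + δ)) =
        s * (12 * π ^ 2 * D * ε * nP ^ 2 + 14 * π ^ 2 * (M + 1) * nP + 12 * π ^ 2 * (M + 1) ^ 2) * Z := by
      rw [hX, hδ]; field_simp; ring
    rw [mul_add, hXκ, hX]
    linarith
  have key := div_le_of_packet_bounds hXpos hs0 hκ0 hδ0 hδhalf hF' hNlo' hNhi' hĝ hĝg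
  refine key.trans ?_
  have := mul_le_mul_of_nonneg_left hbudget hs0
  linarith

/-! ### The packet lemma -/

/-- **The packet lemma** (item stmt-AnomalousDissipation-14032, `K₁ = 2²³`): localisation of the
inertial quadratic form above the resolution by an explicit Fejér–Jackson curl packet (see the
module docstring). [folklore] -/
theorem packetLemma_proof : Summit.AnomalousDissipation.AnomalousDissipation.Theses.TaylorCertificates.PacketLemma := by
  refine ⟨2 ^ 23, fun D hD W _hWsmooth _hWdiv hWtr s hs x₀ ξ hξ => ?_⟩
  classical
  -- `s ≥ 0` and the band-limited form of `W`
  have hs0 : 0 ≤ s := (abs_nonneg _).trans (hs x₀ ξ hξ)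
  have hWeq : W = realTrigPoly (freqBall D) (fun k => mFourierCoeff (EuclideanSpace.complexify ∘ W) k) := by
    rw [← fourierTruncate_eq]; exact hWtr.symm
  have hA : ∀ (x : UnitAddTorus (Fin 3)) (η : EuclideanSpace ℝ (Fin 3)), ‖η‖ = 1 →
      |inner ℝ η (Torus.fderiv W x η)| ≤ s := fun x η hη => hs x η hη
  -- resolution of the envelope
  obtain ⟨M, hM⟩ : ∃ M : ℕ, M + 1 = 2 ^ 10 * D := ⟨2 ^ 10 * D - 1, Nat.sub_add_cancel (by
    calc 1 ≤ D := hD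
      _ ≤ 2 ^ 10 * D := Nat.le_mul_of_pos_left D (by positivity))⟩
  have hDr : (1 : ℝ) ≤ D := by exact_mod_cast hD
  have hMr : (M : ℝ) + 1 = 2 ^ 10 * D := by exact_mod_cast hM
  -- ### the carrier
  obtain ⟨u, hu1, huξ⟩ := exists_unit_perp ξ hξ
  obtain ⟨p, hp⟩ := exists_latticeVec_near (((2 : ℝ) ^ 22 * D) • u)
  have hR0 : (0 : ℝ) ≤ 2 ^ 22 * D := by positivity
  have hpR_lo : (2 : ℝ) ^ 22 * D - 1 ≤ ‖latticeVec p‖ := by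
    have h := norm_sub_norm_le (((2 : ℝ) ^ 22 * D) • u) (latticeVec p)
    rw [norm_smul, hu1, mul_one, Real.norm_eq_abs, abs_of_nonneg hR0, norm_sub_rev] at h
    linarith
  have hpR_hi : ‖latticeVec p‖ ≤ (2 : ℝ) ^ 22 * D + 1 := by
    have h := norm_le_norm_add_norm_sub' (latticeVec p) (((2 : ℝ) ^ 22 * D) • u)
    rw [norm_smul, hu1, mul_one, Real.norm_eq_abs, abs_of_nonneg hR0] at h
    linarith
  have hpξ : |inner ℝ (latticeVec p) ξ| ≤ 1 := by
    have h1 : inner ℝ (latticeVec p) ξ = inner ℝ (latticeVec p - ((2 : ℝ) ^ 22 * D) • u) ξ := by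
      rw [inner_sub_left, inner_smul_left, huξ, mul_zero, sub_zero]
    rw [h1]
    refine (abs_real_inner_le_norm _ _).trans ?_
    rw [hξ, mul_one]; exact hp
  have hp2 : (2 : ℝ) ≤ ‖latticeVec p‖ := by nlinarith
  obtain ⟨a, P, hPdef, ha1, hPn, hgeom⟩ := carrier_frame ξ (latticeVec p) hξ hp2 hpξ
  obtain ⟨hshell, hpfar, h0S⟩ := carrier_frequencies hD hM hpR_lo hpR_hi
  have hPpos : 0 < ‖P‖ := by rw [hPn]; linarith
  -- ### the envelope
  obtain ⟨ψ, hψdef⟩ : ∃ ψ : UnitAddTorus (Fin 3) → ℝ, ∀ x, ψ x = ∏ i, ‖dirChar M (x i - x₀ i)‖ ^ 2 :=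
    ⟨_, fun x => rfl⟩
  obtain ⟨α, hαdef⟩ : ∃ α : (Fin 3 → ℤ) → ℂ,
      α = fun k => ∏ i, ((diffCount M (k i) : ℂ) * (starRingEnd ℂ) (fourier (k i) (x₀ i))) := ⟨_, rfl⟩
  have hψ : ∀ x, ((ψ x : ℝ) : ℂ) = trigPoly (freqCube M) α x := fun x => by
    rw [hψdef, hαdef]; exact ofReal_envelope_eq_trigPoly M x₀ x
  have hψfun : ψ = fun x => ∏ i, ‖dirChar M (x i - x₀ i)‖ ^ 2 := funext hψdef
  obtain ⟨Z, hZ⟩ : ∃ Z : ℝ, Z = ∫ x, ψ x ^ 2 := ⟨_, rfl⟩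
  have hZpos : 0 < Z := by rw [hZ, hψfun]; exact integral_envelope_sq_pos M x₀
  obtain ⟨ε, hε⟩ : ∃ ε : ℝ, ε = π ^ 2 / (2 * ((M : ℝ) + 1)) := ⟨_, rfl⟩
  have hεpos : 0 < ε := by rw [hε]; positivity
  have hwin : ∀ i, ∫ x, ψ x ^ 2 * (‖(1 : ℂ) - fourier 1 (x i - x₀ i)‖ ^ 2 / 4) ≤ ε ^ 2 * ∫ x, ψ x ^ 2 := by
    intro i
    rw [hψfun]
    refine (integral_envelope_sq_mul_window_le M x₀ i).trans ?_
    refine mul_le_mul_of_nonneg_right ?_ (integral_nonneg fun x => sq_nonneg _)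
    rw [hε, div_pow]
    rw [div_le_div_iff₀ (by positivity) (by positivity)]
    nlinarith [Real.pi_pos, pow_pos Real.pi_pos 4]
  -- ### the packet and the two estimates
  obtain ⟨c, hc⟩ : ∃ c : (Fin 3 → ℤ) → EuclideanSpace ℂ (Fin 3), ∀ m, c m = ((2 * π : ℂ) * α (m - p)) •
      EuclideanSpace.complexify (WithLp.toLp 2 (crossProduct (WithLp.ofLp (latticeVec m)) (WithLp.ofLp a)) :
        EuclideanSpace ℝ (Fin 3)) := ⟨_, fun m => rfl⟩
  obtain ⟨uu, huu⟩ : ∃ uu : (Fin 3 → ℤ) → EuclideanSpace ℂ (Fin 3), ∀ k, uu k = ((2 * π : ℂ) * α k) •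
      EuclideanSpace.complexify (WithLp.toLp 2 (crossProduct (WithLp.ofLp (latticeVec k)) (WithLp.ofLp a)) :
        EuclideanSpace ℝ (Fin 3)) := ⟨_, fun k => rfl⟩
  obtain ⟨w₀, hw₀⟩ : ∃ w₀ : UnitAddTorus (Fin 3) → EuclideanSpace ℝ (Fin 3),
      w₀ = realTrigPoly ((freqCube M).image (· + p)) c := ⟨_, rfl⟩
  obtain ⟨G, hG⟩ : ∃ G : UnitAddTorus (Fin 3) → ℝ, ∀ x, G x = inner ℝ P (convect (fun _ => P) W x) :=
    ⟨_, fun x => rfl⟩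
  obtain ⟨hF, hNlo, hNhi⟩ := packet_estimates W _ hWeq hs0 hs α ψ hψ x₀ hεpos hwin p hpfar a ha1 P hPdef
    c uu hc huu w₀ hw₀ G hG
  rw [← hZ] at hF hNlo hNhi
  -- ### the energy is positive; normalise
  obtain ⟨N, hN⟩ : ∃ N : ℝ, N = ∫ x, ‖w₀ x‖ ^ 2 := ⟨_, rfl⟩
  rw [← hN] at hNlo hNhi
  have hNpos : 0 < N := by
    refine lt_of_lt_of_le ?_ hNlo
    rw [hPn]
    have h1 : 7 * ((M : ℝ) + 1) < ‖latticeVec p‖ := by nlinarith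
    have h2 : 0 < 2 * π ^ 2 * ‖latticeVec p‖ * Z := by positivity
    nlinarith
  obtain ⟨ŵ, hŵ⟩ : ∃ ŵ : UnitAddTorus (Fin 3) → EuclideanSpace ℝ (Fin 3),
      ŵ = realTrigPoly ((freqCube M).image (· + p)) ((((Real.sqrt N)⁻¹ : ℝ) : ℂ) • c) := ⟨_, rfl⟩
  have hŵx : ∀ x, ŵ x = (Real.sqrt N)⁻¹ • w₀ x := fun x => by
    rw [hŵ, hw₀]; exact realTrigPoly_real_smul _ _ _ x
  obtain ⟨hnorm, hquot⟩ := packet_normalisation W w₀ ŵ hN hNpos hŵx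
  -- ### qualitative properties
  obtain ⟨hsm, hdiv, hmean, htr0, htr1⟩ := packet_qualitative (D := D) (K := 2 ^ 23) h0S
    (fun m hm => by
      obtain ⟨k, hk, rfl⟩ := Finset.mem_image.1 hm
      exact (hshell k hk).1)
    (fun m hm => by
      obtain ⟨k, hk, rfl⟩ := Finset.mem_image.1 hm
      exact (hshell k hk).2)
    (fun m => (((Real.sqrt N)⁻¹ : ℝ) : ℂ) * ((2 * π : ℂ) * α (m - p))) a
    ((((Real.sqrt N)⁻¹ : ℝ) : ℂ) • c) (fun m => by rw [Pi.smul_apply, hc, smul_smul])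
  refine ⟨ŵ, hŵ ▸ hsm, hŵ ▸ hdiv, hŵ ▸ hmean, hŵ ▸ htr0, hŵ ▸ htr1, hnorm, ?_⟩
  -- ### the inequality
  rw [hquot]
  have hĝ : |inner ℝ (‖P‖⁻¹ • P) (Torus.fderiv W x₀ (‖P‖⁻¹ • P))| ≤ s :=
    hA x₀ _ (by rw [norm_smul, norm_inv, norm_norm, inv_mul_cancel₀ hPpos.ne'])
  have hGx₀ : G x₀ = ‖P‖ ^ 2 * inner ℝ (‖P‖⁻¹ • P) (Torus.fderiv W x₀ (‖P‖⁻¹ • P)) := by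
    rw [hG, convect, map_smul, inner_smul_left, inner_smul_right, conj_trivial]
    field_simp
  have hĝg : inner ℝ (‖P‖⁻¹ • P) (Torus.fderiv W x₀ (‖P‖⁻¹ • P)) ≤
      inner ℝ ξ (convect (fun _ => ξ) W x₀) + s * (2 / ‖P‖) := by
    have h1 := (le_abs_self _).trans (abs_inner_sub_inner_le (Torus.fderiv W x₀) (hA x₀) (‖P‖⁻¹ • P) ξ)
    have h2 : s * ‖‖P‖⁻¹ • P + ξ‖ * ‖‖P‖⁻¹ • P - ξ‖ ≤ s * (2 / ‖P‖) := by
      rw [mul_assoc]; exact mul_le_mul_of_nonneg_left (hPn ▸ hgeom) hs0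
    simp only [convect]
    linarith
  rw [hGx₀] at hF
  obtain ⟨hδhalf, hbudget⟩ := error_budget hD hM (hPn ▸ hpR_lo)
  rw [hε] at hF hεpos
  exact final_inequality hZpos hPpos hs0 hεpos hF hNlo hNhi hĝ hĝg hδhalf hbudget

end Summit.AnomalousDissipation.AnomalousDissipation.Theorems
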